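import Summits.CriticalPhenomena.Ising3DConformalLimit.Theses.EnergyNotSigmaSquared
import Literature.Probability.LatticeModels.RandomCurrents
import Literature.Probability.LatticeModels.WeightedCurrents
import Literature.Probability.LatticeModels.RandomCluster

/-!
# Sketch — crux-ideate stmt-CriticalPhenomena-4469 (EnergyGapPowerLaw), ideator 3, round 1

First lemmas of the three idea cards (elaboration only; nothing is proved here).
-/

noncomputable section

open scoped BigOperators symmDiff
open MeasureTheory Finset Classical

namespace Summit.CriticalPhenomena.Ising3DConformalLimit.Cruxes.EnergyGapPowerLaw.Ideator3

open Literature.Probability.LatticeModels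

/-- Card A, first lemma (HOLE IDENTITY, finite graph, free b.c., zero field, `β ≥ 0`, four
distinct vertices): the truncated "energy–energy" correlation equals, pairing by pairing, the
two-point function of one pair in the complement of the DUPLICATED random-current cluster of the
other pair:
`⟨σ_aσ_bσ_xσ_y⟩ − ⟨σ_aσ_b⟩⟨σ_xσ_y⟩ = ⟨σ_bσ_y⟩ · E^{{b,y},∅}[⟨σ_aσ_x⟩_{V ∖ 𝒞_b}]
  + ⟨σ_bσ_x⟩ · E^{{b,x},∅}[⟨σ_aσ_y⟩_{V ∖ 𝒞_b}]`,
where `𝒞_b` is the cluster of `b` in `n₁+n₂` and `⟨·⟩_{V∖𝒞}` is the free Ising model on the graph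
with all edges meeting `𝒞` removed (`offGraph`), so that the summand vanishes when `a` or the far
point lies in `𝒞_b`. Ingredients in tree: EnergyFactorisation (item 4472) and
`WeightedClusterDecomposition.cluster_decomposition`. -/
def HoleIdentity : Prop :=
  ∀ (V : Type) [Fintype V] [DecidableEq V] (G : SimpleGraph V) [DecidableRel G.Adj] (β : ℝ),
    0 ≤ β → ∀ a b x y : V, a ≠ b → a ≠ x → a ≠ y → b ≠ x → b ≠ y → x ≠ y →
    nPoint (isingMeasure G Finset.univ β 0 .free) spinAt ![a, b, x, y]
        - isingTwoPoint G Finset.univ β 0 .free a b * isingTwoPoint G Finset.univ β 0 .free x y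
      = isingTwoPoint G Finset.univ β 0 .free b y *
          ∫ p, isingTwoPoint (offGraph G ((p.1 + p.2).cluster b)) Finset.univ β 0 .free a x
            ∂(doubleCurrentMeasure G β ({b} ∆ {y}) ∅)
        + isingTwoPoint G Finset.univ β 0 .free b x *
          ∫ p, isingTwoPoint (offGraph G ((p.1 + p.2).cluster b)) Finset.univ β 0 .free a y
            ∂(doubleCurrentMeasure G β ({b} ∆ {x}) ∅)

/-- Card B, first lemma (MARKOV–FKG SANDWICH on an arbitrary finite graph — the perforation is
absorbed into the graph `G`): the free two-point function is bounded by the product of the two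
plus-boundary magnetisations of any two disjoint, non-adjacent neighbourhoods. -/
def MarkovSandwich : Prop :=
  ∀ (V : Type) [Fintype V] [DecidableEq V] (G : SimpleGraph V) [DecidableRel G.Adj] (β : ℝ),
    0 ≤ β → ∀ (S T : Finset V) (a b : V), a ∈ S → b ∈ T → Disjoint S T →
    (∀ u ∈ S, ∀ v ∈ T, ¬ G.Adj u v) →
    isingTwoPoint G Finset.univ β 0 .free a b
      ≤ isingExpect G S β 0 .plus (spinAt a) * isingExpect G T β 0 .plus (spinAt b)

/-- Card C, first lemma (FAT-AVOIDANCE LOWER BOUND = the lower half of the sandwich, finite graph):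
the truncated energy correlation dominates the disconnected product times the probability that two
INDEPENDENT duplicated clusters are disjoint (event written with `tracedConn` exactly as in item
RungOneAdjacentMerging). Consequence: RungOne-type fat avoidance is NECESSARY for the crux. -/
def FatAvoidanceLowerBound : Prop :=
  ∀ (V : Type) [Fintype V] [DecidableEq V] (G : SimpleGraph V) [DecidableRel G.Adj] (β : ℝ),
    0 ≤ β → ∀ a b x y : V, a ≠ b → a ≠ x → a ≠ y → b ≠ x → b ≠ y → x ≠ y →
    isingTwoPoint G Finset.univ β 0 .free a x * isingTwoPoint G Finset.univ β 0 .free b y *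
        ((doubleCurrentMeasure G β ({a} ∆ {x}) ∅).prod (doubleCurrentMeasure G β ({b} ∆ {y}) ∅)).real
          {pq | ∀ u : V, ¬ (pq.1 ∈ tracedConn G a u ∧ pq.2 ∈ tracedConn G b u)}
      + isingTwoPoint G Finset.univ β 0 .free a y * isingTwoPoint G Finset.univ β 0 .free b x *
        ((doubleCurrentMeasure G β ({a} ∆ {y}) ∅).prod (doubleCurrentMeasure G β ({b} ∆ {x}) ∅)).real
          {pq | ∀ u : V, ¬ (pq.1 ∈ tracedConn G a u ∧ pq.2 ∈ tracedConn G b u)}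
      ≤ nPoint (isingMeasure G Finset.univ β 0 .free) spinAt ![a, b, x, y]
        - isingTwoPoint G Finset.univ β 0 .free a b * isingTwoPoint G Finset.univ β 0 .free x y

/-- Card B, the margin-free geometric input it leans on (ONE-ARM HYPERSCALING in the comparable
form; K1 of card flat-isotherm-subquadratic-mgf plus comparability at scale `‖x‖`):
`a(⌊‖x‖_∞/2⌋ − 1)² ≤ C ⟨σ₀σ_x⟩_{β_c}` where `a(r) = ⟨σ₀⟩^+_{Λ_r, β_c}`. -/
def OneArmHyperscalingCmp : Prop :=
  ∃ C : ℝ, ∀ x : Site 3, x ≠ 0 →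
    (isingExpect (zdGraph 3) (box 3 (Site.supNorm x / 2 - 1)) (criticalBeta 3) 0 .plus (spinAt 0)) ^ 2
      ≤ C * criticalTwoPoint 3 x

/-- Card B, the ONE-ENDED HOLE OPACITY it transfers the crux to (finite-volume free-box form, as in
RungOneAdjacentMerging: the graph is `ℤ³` induced on `Λ_n`, `n → ∞` first): with `𝒞` the cluster
of `e₂` in the duplicated current with sources `{e₂, x+e₂}` and `∅`, the plus-boundary
magnetisation felt at `0` from the sphere of radius `r = ⌊‖x‖_∞/2⌋ − 1` through the ball
PERFORATED by `𝒞` (edges meeting `𝒞` removed) is, in mean, at most `C r^{-κ}` times the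
unperforated one. -/
def HoleOpacityOneEnded : Prop :=
  ∃ κ C : ℝ, 0 < κ ∧ ∀ x : Site 3, x ≠ 0 → ∃ n₀ : ℕ, ∀ n : ℕ, n₀ ≤ n →
    ∀ o a y' : ↥(box 3 n), (o : Site 3) = 0 → (a : Site 3) = Pi.single 1 1 →
      (y' : Site 3) = x + Pi.single 1 1 →
      let Gn : SimpleGraph ↥(box 3 n) := (zdGraph 3).comap (Subtype.val : ↥(box 3 n) → Site 3)
      let r : ℕ := Site.supNorm x / 2 - 1
      let B : Finset ↥(box 3 n) := Finset.univ.filter fun v => Site.supNorm (v : Site 3) ≤ r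
      ∫ p, isingExpect (offGraph Gn ((p.1 + p.2).cluster a)) B (criticalBeta 3) 0 .plus (spinAt o)
          ∂(doubleCurrentMeasure Gn (criticalBeta 3) ({a} ∆ {y'}) ∅)
        ≤ C * (r : ℝ) ^ (-κ) * isingExpect Gn B (criticalBeta 3) 0 .plus (spinAt o)

/-- Shape of card B's reduction (to be proved by a crux-plan; here only stated): the Markov
sandwich, one-arm hyperscaling and one-ended hole opacity give the crux BY NAME. -/
def CardB_Reduction : Prop :=
  MarkovSandwich → OneArmHyperscalingCmp → HoleOpacityOneEnded →
    Summit.CriticalPhenomena.Ising3DConformalLimit.Theses.EnergyNotSigmaSquared.EnergyGapPowerLaw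

/-- Card A, provable-now step (FK ROUTING BOUND on transparency, any finite graph): the free
two-point function in the graph perforated at `K` is at most the FK–Ising probability, in the
UNperforated graph, of an open path from `a` to `x` avoiding `K` (domain Markov + FKG for the
random-cluster measure `q = 2`, `p = 1 − e^{−2β}`, free wiring; Edwards–Sokal in tree as
`edwardsSokal_twoPoint_holds`). -/
def TransparencyFKBound : Prop :=
  ∀ (V : Type) [Fintype V] [DecidableEq V] (G : SimpleGraph V) [DecidableRel G.Adj] (β : ℝ),
    0 ≤ β → ∀ (K : Finset V) (a x : V), a ∉ K → x ∉ K →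
    isingTwoPoint (offGraph G K) Finset.univ β 0 .free a x
      ≤ (rcMeasure G (1 - Real.exp (-2 * β)) 2 ∅).real
          (Literature.Probability.Percolation.openConnIn ((↑K : Set V)ᶜ) a x)

/-- Card A, TRANSFER `C⁺` (SEVER, two-ended, finite-volume free-box form as in item
RungOneAdjacentMerging; `n → ∞` first): an INDEPENDENT duplicated random-current cluster `𝒞` of the
pair `(e₂, x+e₂)` severs the critical FK–Ising connection between its neighbours `0` and `x`,
except on an event of relative probability `≤ C ‖x‖^{−κ}`. With HoleIdentity, TransparencyFKBound
and GKS unit-shift comparability this gives the crux. -/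
def SeverTwoEnded : Prop :=
  ∃ κ C : ℝ, 0 < κ ∧ ∀ x : Site 3, x ≠ 0 → ∃ n₀ : ℕ, ∀ n : ℕ, n₀ ≤ n →
    ∀ o a y y' : ↥(box 3 n), (o : Site 3) = 0 → (a : Site 3) = Pi.single 1 1 →
      (y : Site 3) = x → (y' : Site 3) = x + Pi.single 1 1 →
      let Gn : SimpleGraph ↥(box 3 n) := (zdGraph 3).comap (Subtype.val : ↥(box 3 n) → Site 3)
      let φ := rcMeasure Gn (1 - Real.exp (-2 * criticalBeta 3)) 2 ∅
      ((doubleCurrentMeasure Gn (criticalBeta 3) ({a} ∆ {y'}) ∅).prod φ).real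
          {pω | pω.2 ∈ Literature.Probability.Percolation.openConnIn
              ((↑((pω.1.1 + pω.1.2).cluster a) : Set ↥(box 3 n))ᶜ) o y}
        ≤ C * (‖x‖ : ℝ) ^ (-κ) * φ.real (Literature.Probability.Percolation.openConn o y)

/-- Shape of card A's reduction (crux BY NAME). -/
def CardA_Reduction : Prop :=
  HoleIdentity → TransparencyFKBound → SeverTwoEnded →
    Summit.CriticalPhenomena.Ising3DConformalLimit.Theses.EnergyNotSigmaSquared.EnergyGapPowerLaw

end Summit.CriticalPhenomena.Ising3DConformalLimit.Cruxes.EnergyGapPowerLaw.Ideator3
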